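import Mathlib.Analysis.SpecialFunctions.Exp
import Literature.Probability.LatticeModels.Correlations
import HarnessLib

/-!
# The pair-coupling Ising model on a finite set: Boltzmann weight and Gibbs average (light module)

Topic `Literature/Probability/LatticeModels`. The elementary finite-volume, free-boundary,
zero-field Ising model on a finite set `ι` with arbitrary (ordered-)pair couplings
`c : ι → ι → ℝ` (Newman 1975, eq. (1.1); Friedli–Velenik §3.1 (3.8), §3.8.1):

* `PairIsing.gibbsWeight c σ = exp(∑_a ∑_b c a b σ_a σ_b)` — the Boltzmann weight;
* `PairIsing.gibbsAvg c f = (∑_σ f σ · gibbsWeight c σ) / ∑_σ gibbsWeight c σ` — the Gibbs average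
  `⟨f⟩_c`;
* `PairIsing.zeroDiag c` — the couplings with the diagonal zeroed (the diagonal only contributes
  the constant factor `e^{∑_a c_{a,a}}`, which cancels: `gibbsAvg_zeroDiag`);
* the elementary algebra of `gibbsAvg` (`gibbsAvg_def`, `gibbsAvg_add`, `gibbsAvg_const_mul`,
  `gibbsAvg_finset_sum`, `gibbsAvg_const`, `gibbsAvg_nonneg`, `gibbsAvg_zeroDiag`), positivity of
  the weights and of the partition function (`gibbsWeight_pos`, `sum_gibbsWeight_pos`), continuity
  in the couplings (`continuous_gibbsWeight`, `continuous_gibbsAvg`: finite sums of exponentials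
  over a positive denominator), and transport along a bijection of the index set
  (`gibbsWeight_comp_equiv`, `gibbsAvg_comp_equiv`).

## Why this module exists, and its relation to `PairIsing.weight` / `PairIsing.avg`

This is the LIGHT module of the pair-coupling model (definition item `defn-PairIsing.avg`, wanted
by route `CriticalPhenomena/Ising3DConformalLimit/LogPolarProxy`): it imports only
`Correlations` (`SpinConfig ι = ι → ℤˣ`, `spinAt`) and Mathlib, so that route statements and
`Theorems/` files can be stated over the finite Gibbs average without importing the
random-current / GKS / scaling-limit cone of `GaussianPairingBoundCouplings.lean`.

The SAME three objects were first declared in `GaussianPairingBoundCouplings.lean` as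
`PairIsing.weight`, `PairIsing.avg`, `PairIsing.offDiag` (with the lemmas `weight_pos`,
`sum_weight_pos`, `avg_def`, `avg_add`, `avg_const_mul`, `avg_finset_sum`, `avg_const`,
`avg_nonneg`, `sum_sum_coupling_eq`, `weight_eq_exp_mul_weight_offDiag`, `avg_offDiag`,
`continuous_weight`, `continuous_avg`). Those names cannot be relocated here: a fully-qualified
name lives in exactly one module, and `PairIsing.avg` / `PairIsing.weight` are referenced by ten
modules (four of which extend `namespace PairIsing`), so neither "declare here first" nor "delete
there first" is an admissible single-file change. Hence the present definitions carry new names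
and are kept SYNTACTICALLY IDENTICAL to the originals, so that
`PairIsing.weight c ρ = PairIsing.gibbsWeight c ρ`, `PairIsing.avg c f = PairIsing.gibbsAvg c f` and
`PairIsing.offDiag c = PairIsing.zeroDiag c` hold by `rfl` (bridges `PairIsing.weight_eq_gibbsWeight`,
`PairIsing.avg_eq_gibbsAvg`, `PairIsing.offDiag_eq_zeroDiag`, appended to
`GaussianPairingBoundCouplings.lean`, which imports this file). New statements should be written
over `gibbsAvg`; everything proved downstream about `avg` (GKS I/II via `avg_eq_gksExpect`,
Newman's Gaussian inequality `avg_spinMonomial_le_pairingSum`, the moment bound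
`avg_pow_two_mul_le`, `avg_comp_equiv`, …) transfers through the `rfl` bridges.

## References

* C. M. Newman, *Inequalities for Ising models and field theories which obey the Lee–Yang
  theorem*, Comm. Math. Phys. 41 (1975) 1–9, eq. (1.1) (the finite pair-interaction Gibbs
  average) [Newman1975].
* S. Friedli, Y. Velenik, *Statistical Mechanics of Lattice Systems*, CUP (2017), §3.1 eq. (3.8)
  and §3.8.1 (general finite spin systems) [FriedliVelenik2017].

## Design / not here

The curried spelling `c : ι → ι → ℝ` (a coupling MATRIX over ordered pairs; the unordered pair
`{a,b}` thus carries `c a b + c b a`) is the one used by the decoration and continuity arguments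
downstream and by the routes `LogPolarProxy` / `VolterraWard`; no symmetry or sign condition is
imposed (ferromagnetism `c ≥ 0` enters only the correlation inequalities downstream).
Everything is a finite sum; no measure theory. Not here: anything needing `GKSInequalities` or
`GaussianPairingBound` (stays in `GaussianPairingBoundCouplings.lean`).
-/

noncomputable section

namespace Literature.Probability.LatticeModels

namespace PairIsing

variable {ι : Type*} [Fintype ι] [DecidableEq ι]

/-- The Boltzmann weight `exp(∑_{a,b} c_{a,b} σ_a σ_b)` of the Ising model on the finite set `ι` with
the (ordered-)pair couplings `c : ι → ι → ℝ` (free boundary condition, zero field; diagonal terms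
are constants). Light-module spelling of `PairIsing.weight` (definitionally equal).
[cite: Newman1975, eq. (1.1)] -/
def gibbsWeight (c : ι → ι → ℝ) (ρ : SpinConfig ι) : ℝ :=
  Real.exp (∑ a, ∑ b, c a b * (spinAt a ρ * spinAt b ρ))

/-- The Gibbs average `⟨f⟩_c = ∑_σ f(σ) w_c(σ) / ∑_σ w_c(σ)` of the pair-interaction Ising model on
the finite set `ι`. Light-module spelling of `PairIsing.avg` (definitionally equal).
[cite: Newman1975, eq. (1.1)] -/
def gibbsAvg (c : ι → ι → ℝ) (f : SpinConfig ι → ℝ) : ℝ :=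
  (∑ ρ, f ρ * gibbsWeight c ρ) / ∑ ρ, gibbsWeight c ρ

/-- The couplings with the diagonal zeroed. Light-module spelling of `PairIsing.offDiag`
(definitionally equal). [folklore] -/
def zeroDiag (c : ι → ι → ℝ) (a b : ι) : ℝ := if a = b then 0 else c a b

omit [DecidableEq ι] in
/-- Boltzmann weights are positive. [folklore] -/
theorem gibbsWeight_pos (c : ι → ι → ℝ) (ρ : SpinConfig ι) : 0 < gibbsWeight c ρ := Real.exp_pos _

/-- The partition function is positive. [folklore] -/
theorem sum_gibbsWeight_pos (c : ι → ι → ℝ) : 0 < ∑ ρ, gibbsWeight c ρ :=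
  Finset.sum_pos (fun ρ _ => gibbsWeight_pos c ρ) Finset.univ_nonempty

/-- Unfolding of `gibbsAvg`. [folklore] -/
theorem gibbsAvg_def (c : ι → ι → ℝ) (f : SpinConfig ι → ℝ) :
    gibbsAvg c f = (∑ ρ, f ρ * gibbsWeight c ρ) / ∑ ρ, gibbsWeight c ρ := rfl

/-- Additivity of the Gibbs average. [folklore] -/
theorem gibbsAvg_add (c : ι → ι → ℝ) (f g : SpinConfig ι → ℝ) :
    gibbsAvg c (fun ρ => f ρ + g ρ) = gibbsAvg c f + gibbsAvg c g := by
  simp only [gibbsAvg, add_mul, Finset.sum_add_distrib, add_div]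

/-- Homogeneity of the Gibbs average. [folklore] -/
theorem gibbsAvg_const_mul (c : ι → ι → ℝ) (r : ℝ) (f : SpinConfig ι → ℝ) :
    gibbsAvg c (fun ρ => r * f ρ) = r * gibbsAvg c f := by
  simp only [gibbsAvg, mul_assoc, ← Finset.mul_sum, mul_div_assoc]

/-- The Gibbs average of a difference. [folklore] -/
theorem gibbsAvg_sub (c : ι → ι → ℝ) (f g : SpinConfig ι → ℝ) :
    gibbsAvg c (fun ρ => f ρ - g ρ) = gibbsAvg c f - gibbsAvg c g := by
  simp only [gibbsAvg, sub_mul, Finset.sum_sub_distrib, sub_div]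

/-- The Gibbs average commutes with finite sums. [folklore] -/
theorem gibbsAvg_finset_sum (c : ι → ι → ℝ) {κ : Type*} (s : Finset κ) (f : κ → SpinConfig ι → ℝ) :
    gibbsAvg c (fun ρ => ∑ i ∈ s, f i ρ) = ∑ i ∈ s, gibbsAvg c (f i) := by
  simp only [gibbsAvg, Finset.sum_mul, Finset.sum_div]
  exact Finset.sum_comm

/-- `⟨r⟩ = r`. [folklore] -/
theorem gibbsAvg_const (c : ι → ι → ℝ) (r : ℝ) : gibbsAvg c (fun _ => r) = r := by
  rw [gibbsAvg, ← Finset.mul_sum, mul_div_assoc, div_self (sum_gibbsWeight_pos c).ne', mul_one]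

/-- `⟨f⟩ ≥ 0` for `f ≥ 0`. [folklore] -/
theorem gibbsAvg_nonneg (c : ι → ι → ℝ) {f : SpinConfig ι → ℝ} (hf : ∀ ρ, 0 ≤ f ρ) :
    0 ≤ gibbsAvg c f :=
  div_nonneg (Finset.sum_nonneg fun ρ _ => mul_nonneg (hf ρ) (gibbsWeight_pos c ρ).le)
    (sum_gibbsWeight_pos c).le

/-- Monotonicity of the Gibbs average: `f ≤ g ⇒ ⟨f⟩ ≤ ⟨g⟩`. [folklore] -/
theorem gibbsAvg_mono (c : ι → ι → ℝ) {f g : SpinConfig ι → ℝ} (hfg : ∀ ρ, f ρ ≤ g ρ) :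
    gibbsAvg c f ≤ gibbsAvg c g :=
  div_le_div_of_nonneg_right
    (Finset.sum_le_sum fun ρ _ => mul_le_mul_of_nonneg_right (hfg ρ) (gibbsWeight_pos c ρ).le)
    (sum_gibbsWeight_pos c).le

/-- `|⟨f⟩| ≤ ⟨|f|⟩`. [folklore] -/
theorem abs_gibbsAvg_le (c : ι → ι → ℝ) (f : SpinConfig ι → ℝ) :
    |gibbsAvg c f| ≤ gibbsAvg c (fun ρ => |f ρ|) := by
  rw [gibbsAvg, gibbsAvg, abs_div, abs_of_pos (sum_gibbsWeight_pos c)]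
  refine div_le_div_of_nonneg_right ?_ (sum_gibbsWeight_pos c).le
  refine (Finset.abs_sum_le_sum_abs _ _).trans (Finset.sum_le_sum fun ρ _ => ?_)
  rw [abs_mul, abs_of_pos (gibbsWeight_pos c ρ)]

/-- The exponent splits into the constant diagonal part and the off-diagonal part (`σ_a² = 1`).
[folklore] -/
theorem sum_sum_coupling_eq_zeroDiag (c : ι → ι → ℝ) (ρ : SpinConfig ι) :
    ∑ a, ∑ b, c a b * (spinAt a ρ * spinAt b ρ) =
      (∑ a, c a a) + ∑ a, ∑ b, zeroDiag c a b * (spinAt a ρ * spinAt b ρ) := by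
  rw [← Finset.sum_add_distrib]
  refine Finset.sum_congr rfl fun a _ => ?_
  have h : ∀ b, c a b * (spinAt a ρ * spinAt b ρ) =
      (if a = b then c a b * (spinAt a ρ * spinAt b ρ) else 0) +
        zeroDiag c a b * (spinAt a ρ * spinAt b ρ) := by
    intro b
    unfold zeroDiag
    split_ifs <;> ring
  rw [Finset.sum_congr rfl fun b _ => h b, Finset.sum_add_distrib, Finset.sum_ite_eq]
  simp

/-- `w_c = e^{∑_a c_{a,a}} w_{zeroDiag c}`. [folklore] -/
theorem gibbsWeight_eq_exp_mul_gibbsWeight_zeroDiag (c : ι → ι → ℝ) (ρ : SpinConfig ι) :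
    gibbsWeight c ρ = Real.exp (∑ a, c a a) * gibbsWeight (zeroDiag c) ρ := by
  rw [gibbsWeight, gibbsWeight, sum_sum_coupling_eq_zeroDiag, Real.exp_add]

/-- The Gibbs average does not see the diagonal couplings. [folklore] -/
theorem gibbsAvg_zeroDiag (c : ι → ι → ℝ) (f : SpinConfig ι → ℝ) :
    gibbsAvg (zeroDiag c) f = gibbsAvg c f := by
  rw [gibbsAvg, gibbsAvg]
  simp_rw [gibbsWeight_eq_exp_mul_gibbsWeight_zeroDiag c]
  rw [show ∑ ρ, f ρ * (Real.exp (∑ a, c a a) * gibbsWeight (zeroDiag c) ρ) =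
      Real.exp (∑ a, c a a) * ∑ ρ, f ρ * gibbsWeight (zeroDiag c) ρ by
    rw [Finset.mul_sum]; exact Finset.sum_congr rfl fun ρ _ => by ring,
    ← Finset.mul_sum, mul_div_mul_left _ _ (Real.exp_pos _).ne']

omit [DecidableEq ι] in
/-- Continuity of the weights in the couplings. [folklore] -/
theorem continuous_gibbsWeight (ρ : SpinConfig ι) :
    Continuous fun c : ι → ι → ℝ => gibbsWeight c ρ := by
  unfold gibbsWeight
  refine Real.continuous_exp.comp ?_
  refine continuous_finsetSum _ fun a _ => continuous_finsetSum _ fun b _ => ?_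
  exact (continuous_apply_apply a b).mul continuous_const

/-- Continuity of the Gibbs average in the couplings (finite sums of exponentials over a positive
partition function). [folklore] -/
theorem continuous_gibbsAvg (f : SpinConfig ι → ℝ) :
    Continuous fun c : ι → ι → ℝ => gibbsAvg c f := by
  unfold gibbsAvg
  refine Continuous.div ?_ ?_ fun c => (sum_gibbsWeight_pos c).ne'
  · exact continuous_finsetSum _ fun ρ _ => continuous_const.mul (continuous_gibbsWeight ρ)
  · exact continuous_finsetSum _ fun ρ _ => continuous_gibbsWeight ρ

/-! ### Transport along a bijection of the index set -/

section Transport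

variable {κ : Type*} [Fintype κ] [DecidableEq κ]

omit [DecidableEq ι] [DecidableEq κ] in
/-- The Boltzmann weight of the pulled-back couplings `c ∘ (e × e)` at `s` is the weight of `c` at
the pushed-forward configuration `s ∘ e⁻¹`. [folklore] -/
theorem gibbsWeight_comp_equiv (e : ι ≃ κ) (c : κ → κ → ℝ) (s : SpinConfig ι) :
    gibbsWeight (fun a b => c (e a) (e b)) s = gibbsWeight c (s ∘ e.symm) := by
  rw [gibbsWeight, gibbsWeight]
  congr 1
  refine Fintype.sum_equiv e _ _ fun a => ?_
  refine Fintype.sum_equiv e _ _ fun b => ?_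
  simp [spinAt]

/-- **Relabelling invariance of the Gibbs average**: for a bijection `e : ι ≃ κ`,
`⟨f(· ∘ e⁻¹)⟩_{c ∘ (e × e)} = ⟨f⟩_c`. In particular a bijection of `ι` preserving the couplings
preserves all averages (the symmetry argument behind `LogPolarProxy.ProxyReflectionSymmetry`).
[folklore] -/
theorem gibbsAvg_comp_equiv (e : ι ≃ κ) (c : κ → κ → ℝ) (f : SpinConfig κ → ℝ) :
    gibbsAvg (fun a b => c (e a) (e b)) (fun s => f (s ∘ e.symm)) = gibbsAvg c f := by
  have harr : ∀ s : SpinConfig ι, (e.arrowCongr (Equiv.refl ℤˣ)) s = s ∘ e.symm := fun s => rfl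
  have hn : ∑ s : SpinConfig ι, f (s ∘ e.symm) * gibbsWeight (fun a b => c (e a) (e b)) s =
      ∑ t : SpinConfig κ, f t * gibbsWeight c t :=
    Fintype.sum_equiv (e.arrowCongr (Equiv.refl ℤˣ)) _ _ fun s => by
      rw [harr, gibbsWeight_comp_equiv]
  have hd : ∑ s : SpinConfig ι, gibbsWeight (fun a b => c (e a) (e b)) s =
      ∑ t : SpinConfig κ, gibbsWeight c t :=
    Fintype.sum_equiv (e.arrowCongr (Equiv.refl ℤˣ)) _ _ fun s => by
      rw [harr, gibbsWeight_comp_equiv]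
  rw [gibbsAvg_def, gibbsAvg_def, hn, hd]

/-- **Invariance under a coupling-preserving symmetry**: if the bijection `e : ι ≃ ι` preserves
the couplings, `c (e a) (e b) = c a b`, then `⟨f(· ∘ e⁻¹)⟩_c = ⟨f⟩_c`. [folklore] -/
theorem gibbsAvg_comp_equiv_of_invariant (e : ι ≃ ι) {c : ι → ι → ℝ}
    (hc : ∀ a b, c (e a) (e b) = c a b) (f : SpinConfig ι → ℝ) :
    gibbsAvg c (fun s => f (s ∘ e.symm)) = gibbsAvg c f := by
  have h := gibbsAvg_comp_equiv e c f
  simp only [hc] at h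
  exact h

end Transport

end PairIsing

end Literature.Probability.LatticeModels

end
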